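import Summits.NavierStokesRegularity.NavierStokesRegularity.Theorems.TerminalTraceTypeITraceScarL3QuietShellRepresentative
import Literature.Analysis.FluidPDE.NSBootstrapContinuousRep
import HarnessLib

/-!
# Derivative data of the classical representative on a quiet annulus (ROUND-27 «THE √2 APEX», T27-A′
# assembly, part 1) — item `TerminalTrace.TypeITraceScarL3`, stmt-NavierStokesRegularity-18385; helpers

Seat nsreg-C26-p1 g2 (cell ns-regularity-ideate), `--supports stmt-NavierStokesRegularity-18385` (helper).

* `iteratedFDeriv_repr_le_on_annulus` — let `(U, P)` be suitable in every `Q(a)` with the plain pressure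
  bound `D ≤ D₀` and weakly null top, QUIET on the shell slab `]−δ,0[ × {R < |y| < AR}`; let `V` be ANY
  field continuous on the lower slab `]−∞,0[ × ℝ³` with `U = V` a.e. there (e.g. the classical representative
  of `exists_classical_repr_of_apexPackage`).  Then on the middle-third shell, at all times `t ∈ ]−δ/2, 0[` and all
  points `(2R+AR)/3 < |y| < (R+2AR)/3`, `‖DⁿV(t)(y)‖ ≤ K'` for `n ≤ 4`, for some `K' ≥ 0`: the quiet-shell
  representative of `exists_quietShell_representative` (ESŠ local regularity, uniform up to the top) IS `V` on that
  open slab (two continuous functions a.e. equal on an open set agree), and iterated derivatives are local.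
* `ae_slice_eq_of_ae_eq_slab` — `U(s,·) = V(s,·)` a.e. in space, for a.e. `s < 0`.

WHAT THIS IS NOT: not T27-A, not NS regularity — bookkeeping.  [folklore; EscauriazaSereginSverak2003 §3]
-/

noncomputable section

set_option linter.dupNamespace false

namespace Summit.NavierStokesRegularity.NavierStokesRegularity.Theorems.TypeITraceScarL3

open MeasureTheory Set Function Filter Topology Metric InnerProductSpace
open Literature.Analysis Literature.Analysis.FluidPDE
open scoped NNReal ENNReal RealInnerProductSpace

/-- Slices of an a.e. equality on the lower slab. [folklore] -/
theorem ae_slice_eq_of_ae_eq_slab {U V : ℝ → EuclideanSpace ℝ (Fin 3) → EuclideanSpace ℝ (Fin 3)}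
    (hUV : ∀ᵐ w ∂(volume.restrict (Iio (0 : ℝ) ×ˢ (univ : Set (EuclideanSpace ℝ (Fin 3))))),
      uncurry U w = uncurry V w) :
    ∀ᵐ s ∂(volume.restrict (Iio (0 : ℝ))), ∀ᵐ y : EuclideanSpace ℝ (Fin 3), U s y = V s y := by
  have h1 : ∀ᵐ z ∂((volume.restrict (Iio (0 : ℝ))).prod (volume : Measure (EuclideanSpace ℝ (Fin 3)))),
      uncurry U z = uncurry V z := by
    rw [← Measure.restrict_univ (μ := (volume : Measure (EuclideanSpace ℝ (Fin 3)))),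
      Measure.prod_restrict, ← Measure.volume_eq_prod]
    exact hUV
  exact Measure.ae_ae_of_ae_prod h1

/-- **Uniform derivative bounds for the representative on the middle-third shell** (module docstring).
[folklore; EscauriazaSereginSverak2003 §3 (3.25)–(3.31)] -/
theorem iteratedFDeriv_repr_le_on_annulus
    {U V : ℝ → EuclideanSpace ℝ (Fin 3) → EuclideanSpace ℝ (Fin 3)}
    {P : ℝ → EuclideanSpace ℝ (Fin 3) → ℝ}
    (hsw : ∀ a : ℝ, 0 < a →
      IsSuitableWeakSolutionInBall a (0 : ℝ × EuclideanSpace ℝ (Fin 3)) U P)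
    {D₀ : ℝ≥0}
    (hD : ∀ z₀ : ℝ × EuclideanSpace ℝ (Fin 3), z₀.1 ≤ 0 → ∀ r : ℝ, 0 < r → cknD r z₀ P ≤ D₀)
    (htop : ∀ φ : EuclideanSpace ℝ (Fin 3) → EuclideanSpace ℝ (Fin 3), ContDiff ℝ (⊤ : ℕ∞) φ →
      HasCompactSupport φ → ∀ ε : ℝ, 0 < ε →
        ∃ s₀ : ℝ, s₀ < 0 ∧ ∀ᵐ s ∂(volume.restrict (Ioo s₀ 0)), |∫ y, ⟪U s y, φ y⟫| ≤ ε)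
    {δ R A K : ℝ} (hδ : 0 < δ) (hR : 0 < R) (hA : 1 < A)
    (hquiet : ∀ᵐ z ∂(volume.restrict
      (Ioo (-δ) 0 ×ˢ {y : EuclideanSpace ℝ (Fin 3) | R < ‖y‖ ∧ ‖y‖ < A * R})), ‖U z.1 z.2‖ ≤ K)
    (hUV : ∀ᵐ w ∂(volume.restrict (Iio (0 : ℝ) ×ˢ (univ : Set (EuclideanSpace ℝ (Fin 3))))),
      uncurry U w = uncurry V w)
    (hVc : ContinuousOn (uncurry V) (Iio (0 : ℝ) ×ˢ (univ : Set (EuclideanSpace ℝ (Fin 3))))) :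
    ∃ K' : ℝ, 0 ≤ K' ∧ ∀ t ∈ Ioo (-(δ / 2)) 0, ∀ y : EuclideanSpace ℝ (Fin 3),
      (2 * R + A * R) / 3 < ‖y‖ → ‖y‖ < (R + 2 * A * R) / 3 →
        ∀ n ≤ 4, ‖iteratedFDeriv ℝ n (V t) y‖ ≤ K' := by
  have hAR : R < A * R := by nlinarith
  have hR₁ : R < (2 * R + A * R) / 3 := by linarith
  have hR₂ : (R + 2 * A * R) / 3 < A * R := by linarith
  obtain ⟨K', Vq, hVqU, hVqc, -, -, hbd, -⟩ :=
    exists_quietShell_representative hsw hD htop hquiet (half_pos hδ) (by linarith) hR₁ hR₂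
  set Ω : Set (ℝ × EuclideanSpace ℝ (Fin 3)) :=
    Ioo (-(δ / 2)) 0 ×ˢ {y : EuclideanSpace ℝ (Fin 3) | (2 * R + A * R) / 3 < ‖y‖ ∧ ‖y‖ < (R + 2 * A * R) / 3}
    with hΩ
  have hSo : IsOpen {y : EuclideanSpace ℝ (Fin 3) | (2 * R + A * R) / 3 < ‖y‖ ∧ ‖y‖ < (R + 2 * A * R) / 3} :=
    (isOpen_lt continuous_const continuous_norm).inter (isOpen_lt continuous_norm continuous_const)
  have hΩo : IsOpen Ω := isOpen_Ioo.prod hSo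
  have hΩslab : Ω ⊆ Iio (0 : ℝ) ×ˢ univ := prod_mono (fun t ht => ht.2) (subset_univ _)
  -- `V = Vq` on `Ω`
  have hae : (uncurry V) =ᵐ[volume.restrict Ω] uncurry Vq := by
    have h1 : ∀ᵐ w ∂(volume.restrict Ω), uncurry U w = uncurry V w := ae_restrict_of_ae_restrict_of_subset hΩslab hUV
    filter_upwards [h1, hVqU] with w h1w h2w
    rw [← h1w, ← h2w]
  have heq : EqOn (uncurry V) (uncurry Vq) Ω :=
    NSBootstrap.eqOn_of_ae_eq_of_continuousOn (μ := volume) hΩo (hVc.mono hΩslab) hVqc hae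
  refine ⟨max K' 0, le_max_right _ _, fun t ht y hy1 hy2 n hn => ?_⟩
  have hzΩ : (t, y) ∈ Ω := ⟨ht, hy1, hy2⟩
  -- `V t = Vq t` near `y`
  have hev : V t =ᶠ[𝓝 y] Vq t := by
    filter_upwards [hSo.mem_nhds (show y ∈ {y : EuclideanSpace ℝ (Fin 3) |
      (2 * R + A * R) / 3 < ‖y‖ ∧ ‖y‖ < (R + 2 * A * R) / 3} from ⟨hy1, hy2⟩)] with y' hy'
    exact heq (show (t, y') ∈ Ω from ⟨ht, hy'⟩)
  rw [(hev.iteratedFDeriv ℝ n).eq_of_nhds]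
  exact (hbd n hn (t, y) hzΩ).trans (le_max_left _ _)

end Summit.NavierStokesRegularity.NavierStokesRegularity.Theorems.TypeITraceScarL3

end
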